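import Summits.QuantumAdvantage.QuantumAdvantage.Theorems.CubicForrelationNearExactIsExactKtGapTwoStep

/-!
# Crux `CubicForrelation.NearExactIsExact` (stmt-QuantumAdvantage-14043) — Kasami–Tokura for CUBICS below `2d`, I: tools
  (a rank-two derivative always exists; a minimum-weight quadratic is the intersection of two affine hyperplanes; descent along a period;
  the weight of a cubic supported in an affine hyperplane)

Certificate seat `b2b-cforr-cert` (gen 19).  HONEST FRAMING: elementary coding-theory TOOLS (standard axioms, uniform in the number of bits `m`)
for the brick `…KtThreeStructure.lean`: "a Boolean function of degree `≤ 3` on `m` bits with `0 < #E < 2^{m−2}` ones (`E = {c = 1}`) has its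
support inside an affine hyperplane, or `#E = 7·2^{m−5}`" — the `r = 3` case of Kasami–Tokura's theorem (1970, Thm 1), which yields ALL the
weights of `RM(3,m)` below `2d = 2^{m−2}` at once (`2^{m−2} − 2^{i}`, `(m−3)/2 ≤ i ≤ m−3`; on 12 bits: `512, 768, 896, 960, 992`), in particular
the third and fourth gaps `(960, 992)`, `(992, 1024)` needed by the TYPE-O branch of the `n = 12` ladder below `932/1024`.  NOT summit progress.

* `kt3_quadratic_trichotomy`: a quadratic has `0`, exactly `2^{m−2}`, or at least `3·2^{m−3}` ones (`sw_quadratic_second_weight`).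
* `kt3_periods_small`: the periods `R₀` of any `c` with `0 < #E` and `4·#E < 2^m` satisfy `4·(#R₀ + #E) ≤ 2^m` (`#R₀ = 2^j ∣ #E`).
* `kt3_exists_rank_two_derivative`: a cubic with `0 < #E < 2^{m−2}` has a direction `a` whose derivative `c ⊕ c(·⊕a)` has exactly `2^{m−2}`
  ones (double counting `Σ_a #{c ≠ c(·⊕a)} = 2·#E·(2^m − #E)` against the trichotomy and the few periods).
* `kt3_card_two_hyperplanes`, `kt3_minweight_quadratic_cells`: a quadratic with exactly `2^{m−2}` ones is the indicator of
  `{⟨x,z₁⟩ = b₁} ∩ {⟨x,z₂⟩ = b₂}` for two distinct non-zero `z₁, z₂` (Parseval on the character sums `0, ±2^{m−2}` of a minimum-weight word).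
(Descent along a period and the weight of a cubic supported in a hyperplane are in `…KtThreeHyperplane.lean`.)

References: T. Kasami, N. Tokura, *On the weight structure of Reed–Muller codes*, IEEE Trans. IT 16 (1970) 752–759, Thm 1; F. J. MacWilliams,
N. J. A. Sloane (1977) Ch. 13 §4, Ch. 15 §3; C. Carlet (2021) §4.1.  Everything below is proved from Mathlib and the tree; axioms are the
standard three.
-/

set_option linter.dupNamespace false -- D-0017: single-problem summit ⇒ `QuantumAdvantage.QuantumAdvantage` by design

noncomputable section

namespace Summit.QuantumAdvantage.QuantumAdvantage.Theorems.CubicForrelation.NearExactIsExact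

open Finset
open Literature.Computability.QuantumComplexity
open Literature.Computability.QuantumComplexity.BuzetChailloux (bxor zeroVec bxor_bxor_cancel_left bxor_zeroVec zeroVec_bxor bxor_comm
  bxor_self twist_zeroVec_right twist_bxor_right sum_twist_left)
open Literature.Computability.QuantumComplexity.DerivativeWalsh (W twist_bxor_left)
open Literature.Computability.QuantumComplexity.Simon (twist_eq_one_or)
open Summit.QuantumAdvantage.QuantumAdvantage.Theorems.SignedCubicForrelationNotPrBPP (knf_isDegLeFun_ip)

/-! ### Quadratic weights: `0`, `2^{m-2}`, or `≥ 3·2^{m-3}` -/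

/-- **Trichotomy of quadratic weights.**  A Boolean function of degree `≤ 2` on `m` bits has no ones, exactly `2^{m−2}` ones, or at least
`3·2^{m−3}` ones. [cite: KasamiTokura1970, Thm 1] [cite: MacWilliamsSloane1977, Ch. 15 §2] -/
theorem kt3_quadratic_trichotomy {m : ℕ} (q : (Fin m → Bool) → Bool) (hq : IsDegLeFun 2 q) :
    #(univ.filter fun x => q x = true) = 0 ∨ 4 * #(univ.filter fun x => q x = true) = 2 ^ m ∨
      3 * 2 ^ m ≤ 8 * #(univ.filter fun x => q x = true) := by
  classical
  by_cases h0 : #(univ.filter fun x => q x = true) = 0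
  · exact Or.inl h0
  by_cases hlt : 8 * #(univ.filter fun x => q x = true) < 3 * 2 ^ m
  · obtain ⟨x, hx⟩ := card_pos.1 (Nat.pos_of_ne_zero h0)
    exact Or.inr (Or.inl (sw_quadratic_second_weight q hq ⟨x, (mem_filter.1 hx).2⟩ hlt))
  · exact Or.inr (Or.inr (not_lt.1 hlt))

/-! ### Few periods below `2^{m-2}` -/

/-- **Few periods.**  For any `c : 𝔽₂^m → 𝔽₂` with `0 < #E` and `4·#E < 2^m` (`E = {c = 1}`), the set of periods
`R₀ = {a : c(· ⊕ a) = c}` satisfies `4·(#R₀ + #E) ≤ 2^m`: `#R₀ = 2^j` divides `#E` (the ones are a union of `R₀`-cosets), so `2^j ≤ #E < 2^{m−2}`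
and `2^j ∣ 2^{m−2} − #E`. [folklore] -/
theorem kt3_periods_small {m : ℕ} (c : (Fin m → Bool) → Bool) (hpos : 0 < #(univ.filter fun x => c x = true))
    (h4 : 4 * #(univ.filter fun x => c x = true) < 2 ^ m) :
    4 * (#(univ.filter fun a : Fin m → Bool => ∀ x, c (bxor x a) = c x) + #(univ.filter fun x => c x = true)) ≤ 2 ^ m := by
  classical
  set S := univ.filter (fun x : Fin m → Bool => c x = true) with hSdef
  set R := univ.filter (fun a : Fin m → Bool => ∀ x, c (bxor x a) = c x) with hRdef
  obtain ⟨j, hjm, hR⟩ := sw_card_periods c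
  have hR0 : zeroVec ∈ R := mem_filter.2 ⟨mem_univ _, fun x => by rw [bxor_zeroVec]⟩
  have hRadd : ∀ a ∈ R, ∀ b ∈ R, bxor a b ∈ R := by
    intro a ha b hb
    refine mem_filter.2 ⟨mem_univ _, fun x => ?_⟩
    rw [← iw_bxor_assoc, (mem_filter.1 hb).2, (mem_filter.1 ha).2]
  have hdvd : #R ∣ #S := stub_invariantWeight m c R hR0 hRadd (fun u hu x => (mem_filter.1 hu).2 x)
  change #R = 2 ^ j at hR
  rw [hR] at hdvd ⊢
  have hjle : 2 ^ j ≤ #S := Nat.le_of_dvd hpos hdvd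
  have hj2 : j + 2 < m := by
    by_contra hcon
    have : 2 ^ m ≤ 2 ^ (j + 2) := Nat.pow_le_pow_right (by norm_num) (by omega)
    have : 2 ^ (j + 2) = 4 * 2 ^ j := by ring
    omega
  obtain ⟨e, he⟩ : ∃ e, m = (j + 2) + e := ⟨m - (j + 2), by omega⟩
  have hpow : 2 ^ m = 4 * 2 ^ j * 2 ^ e := by rw [he, pow_add, pow_add]; ring
  obtain ⟨q, hq⟩ := hdvd
  -- `4·2^j ∣ 2^m − 4·#S > 0`
  have h1 : 4 * 2 ^ j ∣ 2 ^ m - 4 * #S := by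
    refine (Nat.dvd_sub ?_ ?_)
    · rw [hpow]; exact dvd_mul_right _ _
    · rw [hq, show 4 * (2 ^ j * q) = 4 * 2 ^ j * q by ring]; exact dvd_mul_right _ _
  have h2 : 0 < 2 ^ m - 4 * #S := by omega
  have h3 := Nat.le_of_dvd h2 h1
  omega

/-! ### A rank-two derivative always exists below `2^{m-2}` -/

/-- **A derivative with exactly `2^{m−2}` ones.**  A Boolean function `c` of degree `≤ 3` on `m` bits with `0 < #E` and `4·#E < 2^m` has a
direction `a` with `4·#{x : c x ≠ c(x ⊕ a)} = 2^m`.  (Otherwise every non-period derivative — a non-zero quadratic — has `≥ 3·2^{m−3}` ones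
by `kt3_quadratic_trichotomy`, and `Σ_a #{c ≠ c(·⊕a)} = 2·#E·(2^m − #E)` (`sw_sum_deriv_card`) with at most `2^{m−2} − #E` periods
(`kt3_periods_small`) is contradictory.) [this work; cite: KasamiTokura1970, Thm 1] -/
theorem kt3_exists_rank_two_derivative {m : ℕ} (c : (Fin m → Bool) → Bool) (hc : IsDegLeFun 3 c)
    (hpos : 0 < #(univ.filter fun x => c x = true)) (h4 : 4 * #(univ.filter fun x => c x = true) < 2 ^ m) :
    ∃ a : Fin m → Bool, 4 * #(univ.filter fun x => (c x ^^ c (bxor x a)) = true) = 2 ^ m := by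
  classical
  set S := univ.filter (fun x : Fin m → Bool => c x = true) with hSdef
  set R := univ.filter (fun a : Fin m → Bool => ∀ x, c (bxor x a) = c x) with hRdef
  by_contra hnone
  push Not at hnone
  have hD : ∀ a, a ∉ R → 3 * 2 ^ m ≤ 8 * #(univ.filter fun x => (c x ^^ c (bxor x a)) = true) := by
    intro a ha
    have hq : IsDegLeFun 2 (fun x => c x ^^ c (bxor x a)) := stub_derivDegree m 2 c a hc
    rcases kt3_quadratic_trichotomy _ hq with h | h | h
    · exact absurd ((sw_mem_periods_iff c a).2 h) ha
    · exact absurd h (hnone a)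
    · exact h
  have hsum := sw_sum_deriv_card c
  rw [← hSdef] at hsum
  have hsplit := sum_filter_add_sum_filter_not univ (fun a => a ∈ R) (fun a => (#(univ.filter fun x => (c x ^^ c (bxor x a)) = true) : ℕ))
  rw [sum_eq_zero fun a ha => (sw_mem_periods_iff c a).1 (mem_filter.1 ha).2, zero_add, hsum] at hsplit
  -- the non-periods
  have hM : #(univ : Finset (Fin m → Bool)) = 2 ^ m := by
    rw [card_univ, Fintype.card_fun, Fintype.card_bool, Fintype.card_fin]
  have hcR : #(univ.filter fun a : Fin m → Bool => ¬ a ∈ R) = 2 ^ m - #R := by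
    have h := card_filter_add_card_filter_not (s := (univ : Finset (Fin m → Bool))) (fun a => a ∈ R)
    rw [filter_mem_eq_inter, univ_inter, hM] at h
    omega
  have hge : #(univ.filter fun a : Fin m → Bool => ¬ a ∈ R) * (3 * 2 ^ m) ≤
      8 * ∑ a ∈ univ.filter (fun a : Fin m → Bool => ¬ a ∈ R), (#(univ.filter fun x => (c x ^^ c (bxor x a)) = true) : ℕ) := by
    rw [mul_sum, ← smul_eq_mul, ← sum_const]
    exact sum_le_sum fun a ha => hD a (mem_filter.1 ha).2
  rw [hsplit, hcR] at hge
  have hRS := kt3_periods_small c hpos h4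
  rw [← hSdef, ← hRdef] at hRS
  have hSle : #S ≤ 2 ^ m := by omega
  have hRle : #R ≤ 2 ^ m := by omega
  -- arithmetic: with `N = 2^m`, `(N − #R)·3N ≤ 16·#S·(N − #S)`, `4(#R + #S) ≤ N`, `0 < #S`, `4#S < N` is impossible
  set N := 2 ^ m with hNdef
  set s := #S with hs
  set r := #R with hr
  have key : (N - r) * (3 * N) ≤ 16 * s * (N - s) := by
    have : 8 * (2 * s * (N - s)) = 16 * s * (N - s) := by ring
    omega
  zify [hSle, hRle] at key hRS h4
  nlinarith [key, hRS, h4, hpos]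

/-! ### Two affine hyperplanes -/

/-- **Two independent affine hyperplanes meet in `2^{m−2}` points**: for distinct non-zero `z₁, z₂` and any `b₁, b₂`,
`4·#{x : ⟨x,z₁⟩ = b₁ ∧ ⟨x,z₂⟩ = b₂} = 2^m` (orthogonality of the characters `(−1)^{x·z₁}`, `(−1)^{x·z₂}`, `(−1)^{x·(z₁⊕z₂)}`). [folklore] -/
theorem kt3_card_two_hyperplanes {m : ℕ} (z₁ z₂ : Fin m → Bool) (hz₁ : z₁ ≠ zeroVec) (hz₂ : z₂ ≠ zeroVec) (h12 : z₁ ≠ z₂)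
    (b₁ b₂ : Bool) :
    4 * #(univ.filter fun x : Fin m → Bool => decide (Odd #(univ.filter fun i => (x i && z₁ i) = true)) = b₁ ∧
      decide (Odd #(univ.filter fun i => (x i && z₂ i) = true)) = b₂) = 2 ^ m := by
  classical
  set ℓ : (Fin m → Bool) → (Fin m → Bool) → Bool :=
    fun z x => decide (Odd #(univ.filter fun i => (x i && z i) = true)) with hℓdef
  have htw : ∀ x z, twist x z = signOf (ℓ z x) := fun x z => vg_twist_eq_signOf x z
  have hind : ∀ (z x : Fin m → Bool) (b : Bool), (if ℓ z x = b then (1 : ℝ) else 0) = (1 + signOf b * twist x z) / 2 := by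
    intro z x b
    rw [htw x z]
    cases ℓ z x <;> cases b <;> norm_num [signOf]
  have hz3 : bxor z₁ z₂ ≠ zeroVec := by
    intro h; apply h12; funext i
    have := congrFun h i
    change (z₁ i ^^ z₂ i) = false at this
    revert this; cases z₁ i <;> cases z₂ i <;> simp
  have hS1 : ∑ x : Fin m → Bool, twist x z₁ = 0 := by rw [sum_twist_left, if_neg hz₁]
  have hS2 : ∑ x : Fin m → Bool, twist x z₂ = 0 := by rw [sum_twist_left, if_neg hz₂]
  have hS3 : ∑ x : Fin m → Bool, twist x z₁ * twist x z₂ = 0 := by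
    simp_rw [← twist_bxor_right]; rw [sum_twist_left, if_neg hz3]
  have hM : ∑ _x : Fin m → Bool, (1 : ℝ) = 2 ^ m := by
    rw [sum_const, card_univ, Fintype.card_fun, Fintype.card_bool, Fintype.card_fin]; norm_num
  have key : ((#(univ.filter fun x : Fin m → Bool => ℓ z₁ x = b₁ ∧ ℓ z₂ x = b₂) : ℕ) : ℝ) * 4 = 2 ^ m := by
    rw [← sum_boole]
    have e : ∀ x : Fin m → Bool, (if (ℓ z₁ x = b₁ ∧ ℓ z₂ x = b₂) then (1 : ℝ) else 0) =
        (if ℓ z₁ x = b₁ then (1 : ℝ) else 0) * (if ℓ z₂ x = b₂ then (1 : ℝ) else 0) := by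
      intro x; by_cases h1 : ℓ z₁ x = b₁ <;> by_cases h2 : ℓ z₂ x = b₂ <;> simp [h1, h2]
    simp_rw [e, hind]
    have e2 : ∀ x : Fin m → Bool, (1 + signOf b₁ * twist x z₁) / 2 * ((1 + signOf b₂ * twist x z₂) / 2) * 4 =
        1 + signOf b₁ * twist x z₁ + signOf b₂ * twist x z₂ + signOf b₁ * signOf b₂ * (twist x z₁ * twist x z₂) := by
      intro x; ring
    rw [sum_mul, sum_congr rfl fun x _ => e2 x, sum_add_distrib, sum_add_distrib, sum_add_distrib, ← mul_sum, ← mul_sum, ← mul_sum,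
      hS1, hS2, hS3, hM]
    ring
  have key' : (((4 * #(univ.filter fun x : Fin m → Bool => ℓ z₁ x = b₁ ∧ ℓ z₂ x = b₂) : ℕ) : ℝ)) = ((2 ^ m : ℕ) : ℝ) := by
    push_cast; linarith
  exact_mod_cast key'

/-! ### A minimum-weight quadratic is the intersection of two affine hyperplanes -/

/-- **Minimum-weight quadratics.**  A Boolean function `q` of degree `≤ 2` on `m` bits with exactly `2^{m−2}` ones is the indicator of
`{⟨x,z₁⟩ = b₁} ∩ {⟨x,z₂⟩ = b₂}` for two distinct non-zero directions `z₁, z₂`: its support `U` is a minimum-weight word of `RM(2,m)`, a flat with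
character sums `0, ±#U` (`ktg2_minweight_twist_sum`); by Parseval exactly four directions carry `±#U`, and on each of them `⟨x,z⟩` is constant
on `U`. [cite: MacWilliamsSloane1977, Ch. 13 §4] -/
theorem kt3_minweight_quadratic_cells {m : ℕ} (q : (Fin m → Bool) → Bool) (hq : IsDegLeFun 2 q)
    (hU : 4 * #(univ.filter fun x => q x = true) = 2 ^ m) :
    ∃ (z₁ z₂ : Fin m → Bool) (b₁ b₂ : Bool), z₁ ≠ zeroVec ∧ z₂ ≠ zeroVec ∧ z₁ ≠ z₂ ∧
      ∀ x, q x = true ↔ (decide (Odd #(univ.filter fun i => (x i && z₁ i) = true)) = b₁ ∧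
        decide (Odd #(univ.filter fun i => (x i && z₂ i) = true)) = b₂) := by
  classical
  set U := univ.filter (fun x : Fin m → Bool => q x = true) with hUdef
  set ℓ : (Fin m → Bool) → (Fin m → Bool) → Bool :=
    fun z x => decide (Odd #(univ.filter fun i => (x i && z i) = true)) with hℓdef
  set G : (Fin m → Bool) → ℝ := fun z => ∑ x ∈ U, twist x z with hGdef
  have hUpos : 0 < #U := by
    rcases Nat.eq_zero_or_pos #U with h | h
    · rw [h] at hU; have := Nat.one_le_two_pow (n := m); omega
    · exact h
  have hUR : (0 : ℝ) < #U := by exact_mod_cast hUpos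
  have hS' : 2 ^ (1 + 1) * #U = 2 ^ m := by rw [← hU]; ring
  have hGval : ∀ z, G z = 0 ∨ G z = #U ∨ G z = -#U := fun z => ktg2_minweight_twist_sum q hq hS' z
  have hG0 : G zeroVec = #U := by
    simp only [G]; rw [sum_congr rfl fun x _ => twist_zeroVec_right x, sum_const]; norm_num
  -- Parseval: exactly four directions carry `±#U`
  set T := univ.filter (fun z : Fin m → Bool => G z ^ 2 = (#U : ℝ) ^ 2) with hTdef
  have hmemT : ∀ z, z ∈ T ↔ G z ^ 2 = (#U : ℝ) ^ 2 := fun z => by rw [hTdef, mem_filter]; simp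
  have hpars : ∑ z, G z ^ 2 = (2 : ℝ) ^ m * #U := ktg_parseval U
  have hsumT : ∑ z, G z ^ 2 = #T * (#U : ℝ) ^ 2 := by
    rw [← sum_filter_add_sum_filter_not univ (fun z => G z ^ 2 = (#U : ℝ) ^ 2)]
    rw [sum_congr rfl (g := fun _ => ((#U : ℝ)) ^ 2) fun z hz => (mem_filter.1 hz).2, sum_const, nsmul_eq_mul]
    rw [sum_eq_zero fun z hz => ?_, add_zero]
    have hz' := (mem_filter.1 hz).2
    rcases hGval z with h | h | h
    · rw [h]; ring
    · exact absurd (by rw [h]) hz'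
    · exact absurd (by rw [h]; ring) hz'
  have hT4 : #T = 4 := by
    have h2m : (2 : ℝ) ^ m = 4 * #U := by exact_mod_cast (show (2 ^ m : ℕ) = 4 * #U by rw [hU])
    rw [hpars, h2m] at hsumT
    have hprod : (((#T : ℕ) : ℝ) - 4) * ((#U : ℝ) ^ 2) = 0 := by linear_combination (-1 : ℝ) * hsumT
    rcases mul_eq_zero.1 hprod with h | h
    · have : ((#T : ℕ) : ℝ) = 4 := by linarith
      exact_mod_cast this
    · exfalso; exact absurd h (by positivity)
  have h0T : zeroVec ∈ T := (hmemT _).2 (by rw [hG0])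
  -- pick two distinct non-zero directions in `T`
  have hT3 : #(T.erase zeroVec) = 3 := by rw [card_erase_of_mem h0T, hT4]
  obtain ⟨z₁, hz₁⟩ : ∃ z₁, z₁ ∈ T.erase zeroVec := card_pos.1 (by rw [hT3]; norm_num)
  have hT2 : #((T.erase zeroVec).erase z₁) = 2 := by rw [card_erase_of_mem hz₁, hT3]
  obtain ⟨z₂, hz₂⟩ : ∃ z₂, z₂ ∈ (T.erase zeroVec).erase z₁ := card_pos.1 (by rw [hT2]; norm_num)
  have hz₁0 : z₁ ≠ zeroVec := (mem_erase.1 hz₁).1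
  have hz₂1 : z₂ ≠ z₁ := (mem_erase.1 hz₂).1
  have hz₂0 : z₂ ≠ zeroVec := (mem_erase.1 (mem_erase.1 hz₂).2).1
  have hz₁T : z₁ ∈ T := (mem_erase.1 hz₁).2
  have hz₂T : z₂ ∈ T := (mem_erase.1 (mem_erase.1 hz₂).2).2
  -- on such a direction `⟨x,z⟩` is constant on `U`
  have hconst : ∀ z ∈ T, ∃ b : Bool, ∀ x ∈ U, ℓ z x = b := by
    intro z hz
    have hF := ktg_F_half q z
    change G z = #U - 2 * (#(univ.filter fun x => q x = true ∧ ℓ z x = true) : ℝ) at hF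
    have hsub : (univ.filter fun x => q x = true ∧ ℓ z x = true) = U.filter (fun x => ℓ z x = true) := by
      ext x; simp only [hUdef, mem_filter, mem_univ, true_and]
    rw [hsub] at hF
    rcases hGval z with h | h | h
    · exfalso
      have := (hmemT z).1 hz
      rw [h] at this
      nlinarith [hUR]
    · refine ⟨false, fun x hx => ?_⟩
      have hc : (#(U.filter fun x => ℓ z x = true) : ℝ) = 0 := by linarith
      have hc' : #(U.filter fun x => ℓ z x = true) = 0 := by exact_mod_cast hc
      have := filter_eq_empty_iff.1 (card_eq_zero.1 hc') hx
      simpa using this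
    · refine ⟨true, fun x hx => ?_⟩
      have hc : (#(U.filter fun x => ℓ z x = true) : ℝ) = #U := by linarith
      have hc' : #(U.filter fun x => ℓ z x = true) = #U := by exact_mod_cast hc
      have heq : U.filter (fun x => ℓ z x = true) = U := eq_of_subset_of_card_le (filter_subset _ _) (by rw [hc'])
      have : x ∈ U.filter (fun x => ℓ z x = true) := by rw [heq]; exact hx
      exact (mem_filter.1 this).2
  obtain ⟨b₁, hb₁⟩ := hconst z₁ hz₁T
  obtain ⟨b₂, hb₂⟩ := hconst z₂ hz₂T
  refine ⟨z₁, z₂, b₁, b₂, hz₁0, hz₂0, fun h => hz₂1 h.symm, ?_⟩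
  -- `U ⊆ H₁ ∩ H₂` and both have `2^{m−2}` elements
  set H := univ.filter (fun x : Fin m → Bool => ℓ z₁ x = b₁ ∧ ℓ z₂ x = b₂) with hHdef
  have hHcard : 4 * #H = 2 ^ m := kt3_card_two_hyperplanes z₁ z₂ hz₁0 hz₂0 (fun h => hz₂1 h.symm) b₁ b₂
  have hsub : U ⊆ H := fun x hx => mem_filter.2 ⟨mem_univ _, hb₁ x hx, hb₂ x hx⟩
  have heq : U = H := eq_of_subset_of_card_le hsub (by omega)
  intro x
  constructor
  · intro hx
    have : x ∈ H := by rw [← heq]; exact mem_filter.2 ⟨mem_univ _, hx⟩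
    exact (mem_filter.1 this).2
  · intro hx
    have : x ∈ U := by rw [heq]; exact mem_filter.2 ⟨mem_univ _, hx⟩
    exact (mem_filter.1 this).2

end Summit.QuantumAdvantage.QuantumAdvantage.Theorems.CubicForrelation.NearExactIsExact

end
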